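import Summits.QuantumFields.YangMills.Theorems.BalabanUVNodesPortS1G3CHolo
import Summits.QuantumFields.YangMills.Theorems.BalabanUVNodesPortS1G3CLocalGauge
import Summits.QuantumFields.YangMills.Theorems.BalabanUVNodesPortS1G3CTwinBridge
import Summits.QuantumFields.YangMills.Theorems.BalabanUVNodesPortS1G3CDefsL

/-!
# NODE O port PT-A — ★★★ `G3CAtRecordL F` IS INHABITED FOR EVERY `F`: the located gap G-P6 (repaired cut) — the resummed generalized random walk expansion of `Tr (x + T)⁻¹` at a complex,
# field-localised carrier with unit-lattice decay — assembled from the hand's layers (α)(α′)(α″)(β)(β′)(β″)(γ)(δ) and ▶ PTA-1's integer twin (ζ); the registered stub `stub_G3C : ∀ F, G3CAtRecordL F`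
# of ⟨stmt-QuantumFields-27930⟩'s line `pta_residueW` (v3.5) follows BY NAME (`g3cAtRecordL_holds`)

Cell `ym-nodeO-ideate`, porter hand `hand-27930-G3C` (g1; director-ym R675-ym ∕ №573 (4)); `--supports stmt-QuantumFields-27930`; count-neutral.  [16] = [Balaban1985UV3],
[B9] = [Balaban1985BackgroundPropagators], [B4] = [Balaban1983RegularityDecay], [I] = [Balaban1987RG1].

THE PROOF (memo `Cruxes/PortRecordRepresentationS1/Lines/pta_residueW-stub_G3C-hand.md` §5b∕§5c, now kernel-checked).  Given `κt > 0` and the absolute constants `c₀ γ₀ γ₁ δ₁`, put `c := 2c₀`,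
`γ := γ₀/2` (the degraded constants of the open neighbourhoods) and the lattice Combes–Thomas rate `κ′ := min(δ₁/2, γδ₁/(4cK₀))`; ✓`exists_thresholds_g3cLam` gives `δG`, `Mth'` (a₀-free) with
`Λ(c, γ, δ₀, κ′, κt, Mc) ≤ ½` for `δ₀ ≥ δG`, `Mc ≥ Mth'`; put `Bc := 2·12(L·Mc)^4·(2/γ₀)·e^{81κt}` (after `Mc`, before `k`).  For carriers satisfying the P0-ℂ body + (P4-lat): `EG x n X φ :=
g3cEG …` (the walk pieces collected at `X_full`, ✓`…G3CWalks`), `EGZ x := g3cWZ F Mc TZY x` (▶ PTA-1, ✓`…G3CTwinObjects`).  (g1) ✓`sum_g3cEG` (every pair); (g2)(g3)(g5) on the open `O_X` of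
✓`exists_open_g3cPt` (point predicate with `(2c₀, γ₀/2)` + analytic entries), where `EG = W` (off `X_full` by ✓`g3cEG_of_ne_full`, at `X_full` by the Neumann identity ✓`g3cEG_eq_g3cW_of_pt`)
and ✓`differentiableOn_g3cW` ∕ ✓`norm_g3cW_le` ∕ ✓`continuousOn_g3cW`; (g4) ✓`g3cEG_congr`; (g6) ✓`g3cEG_cAct`; (gZ) ✓`g3cEGZ_row`.

WHAT THIS FILE PROVES (sorry-free): ★★★ `g3cAtRecordL_holds (F : T4Family) : G3CAtRecordL F`.

HONEST FRAMING.  `G3CAtRecordL F` is a CONDITIONAL letter: «every carrier satisfying `P0CarrierClauses ∧ P0CarrierLatticeDecay` (with `δ₀ ≥ δG`, `Mc ≥ Mth'`) has resolvent pieces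
`G3CPiecesAt` with the target rate `κt`» — this file inhabits it for every `F` (the complex ∕ field-localised ∕ torus edition of [B4] (5.17) + [B9] (3.90) + [16] p.272, as a theorem about
abstract carriers); its ANTECEDENT (the P0-ℂ letter `stub_P0C : ∀ F, P0HolExtAtRecordGL F`, node00-def-Y's M2-ℂ scheme) is inhabited NOWHERE, and `stub_FE` is OPEN — so ⟨27930⟩ stays OPEN
(2 stubs), NODE O 0∕1, COUNT 8∕28 · K 1∕4 UNMOVED; finite `𝕋⁴_{L^K}` at fixed ε — NOT continuum ∕ ℝ⁴ ∕ OS ∕ Clay; **the Yang–Mills mass gap is NOT proved by any of this.**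
No `sorry`, no `instance`, no `notation`; standard axioms.
-/

noncomputable section

open scoped BigOperators Matrix.Norms.L2Operator Topology Matrix Classical
open Filter Finset

namespace Summit.QuantumFields.YangMills.Theorems.BalabanUVNodesPortS1

open Summit.QuantumFields.YangMills.Theorems.K0RecordFormatNames
open Literature.MathematicalPhysics.QuantumFieldTheory.Balaban1983to89
open Literature.MathematicalPhysics.QuantumFieldTheory.Balaban1983to89.Node00
open Literature.MathematicalPhysics.QuantumFieldTheory.Balaban1983to89.T4Continuum (T4Family)
open Literature.MathematicalPhysics.QuantumFieldTheory.Balaban1983to89.TreeLengthTorus (TPt)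
open Literature.MathematicalPhysics.QuantumFieldTheory.Balaban1983to89.B12TreeDecay (K₀ kappa₀ K₀_pos kappa₀_nonneg)

/-- ★★★ **`G3CAtRecordL F` HOLDS FOR EVERY `F`** — the located gap G-P6 of ⟨stmt-QuantumFields-27930⟩ (repaired cut): the resummed generalized random walk expansion (24)–(25) of the
resolvent member `Tr (x + T)⁻¹` of [16] (63) at a complex, field-localised carrier with unit-lattice Schur decay and X-localized coercivity, with target rate `κt` for `δ₀ ≥ δG(κt, c₀, γ₀)`,
`Mc ≥ Mth'(κt, c₀, γ₀, δ₁)` («κ can be arbitrarily large if M is sufficiently large»), the x-uniform (1.18)-type bound `Bc·#X·e^{−κt·d_j(X)}`, holomorphy on an open neighbourhood of the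
record space, x-continuity on `[0, ∞)`, (1.7) locality, (1.19) invariance, and ONE local gauge-invariant integer formula off the centred wrap class.
[cite: Balaban1985UV3, (23)–(25) p.262, (63) p.272; Balaban1985BackgroundPropagators, (3.87)–(3.96) pp.409–411, (3.42) p.399; Balaban1983RegularityDecay, (5.6) p.594, (5.17) p.40;
Balaban1987RG1, (1.7) p.261, (1.18)–(1.19) p.263, (1.21) p.264] -/
theorem g3cAtRecordL_holds (F : T4Family) : G3CAtRecordL F := by
  intro κt hκt c₀ γ₀ γ₁ δ₁ hc₀ hγ₀ _hγ hδ₁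
  -- degraded constants `c := 2c₀`, `γ := γ₀/2` and the lattice Combes–Thomas rate `κ′`
  have hc : (0 : ℝ) ≤ 2 * c₀ := by positivity
  have hγ : (0 : ℝ) < γ₀ / 2 := by positivity
  have hK₀ : 0 < K₀ (4 * 2 ^ 4 : ℝ) (2 * 4) := K₀_pos _ _
  obtain ⟨κ', hκ'def⟩ : ∃ κ' : ℝ, κ' = min (δ₁ / 2) (γ₀ / 2 * δ₁ / (4 * (2 * c₀ * K₀ (4 * 2 ^ 4) (2 * 4)))) := ⟨_, rfl⟩
  have hden : (0 : ℝ) < 4 * (2 * c₀ * K₀ (4 * 2 ^ 4) (2 * 4)) := by positivity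
  have hκ'0 : 0 < κ' := by rw [hκ'def]; exact lt_min (by positivity) (div_pos (by positivity) hden)
  have h2κ : 2 * κ' ≤ δ₁ := by
    have : κ' ≤ δ₁ / 2 := by rw [hκ'def]; exact min_le_left _ _
    linarith
  have h4κ : 4 * κ' * (2 * c₀ * K₀ (4 * 2 ^ 4) (2 * 4)) ≤ γ₀ / 2 * δ₁ := by
    have h1 : κ' ≤ γ₀ / 2 * δ₁ / (4 * (2 * c₀ * K₀ (4 * 2 ^ 4) (2 * 4))) := by rw [hκ'def]; exact min_le_right _ _
    rw [le_div_iff₀ hden] at h1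
    linarith
  -- thresholds
  obtain ⟨δG, hδG, Mth', hthr⟩ := exists_thresholds_g3cLam F hc hγ hκ'0 hκt.le
  refine ⟨δG, hδG, Mth', fun δ₀ hδ₀ Mc hMc hGuard => ?_⟩
  obtain ⟨hΛ, hδ₀'⟩ := hthr δ₀ hδ₀ Mc hMc
  -- the constant `Bc` (after `Mc`, before `k`)
  obtain ⟨Bc, hBcdef⟩ : ∃ Bc : ℝ, Bc = 2 * ((((3 * 4 * (F.L * Mc) ^ 4 : ℕ) : ℝ)) * (1 / (γ₀ / 2)) * Real.exp (κt * ((3 ^ 4 * 3 ^ 4 : ℕ) : ℝ))) := ⟨_, rfl⟩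
  have hBc0 : 0 ≤ Bc := by rw [hBcdef]; positivity
  refine ⟨Bc, hBc0, fun a₀ α₀ α₁ ε₂₉ _ha₀ _hα₀ _hα₁ _hε k TC TY TZY AdM AdZ hP hL => ?_⟩
  refine ⟨fun x n X φ => g3cEG F Mc k (recordK₀ F Mc k + n) (TC n) (TY n) x X φ, fun x => g3cWZ F Mc TZY x, ?_⟩
  refine ⟨fun n => ?_, fun n X => ?_, fun x n X φ ψ h => g3cEG_congr hP n x X h, fun x n X u φ => g3cEG_cAct hP n x X u φ, fun x _ => g3cEGZ_row hP hGuard x⟩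
  · -- (g1): the collector gives the resolvent trace for EVERY pair
    exact Filter.Eventually.of_forall fun B x _ => sum_g3cEG Mc k (TC n) (TY n) x _
  · -- (g2)(g3)(g5) on the open neighbourhood of the record space of `X`
    obtain ⟨O, hOo, hSO, hO⟩ := exists_open_g3cPt hP hL hc₀ hγ₀ n X
    have hEq : ∀ φ ∈ O, ∀ x : ℝ, 0 ≤ x →
        g3cEG F Mc k (recordK₀ F Mc k + n) (TC n) (TY n) x X φ = g3cW F Mc k (recordK₀ F Mc k + n) (TY n) x φ X := by
      intro φ hφ x hx
      by_cases hX : X = g3cFull F Mc k (recordK₀ F Mc k + n)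
      · subst hX
        exact g3cEG_eq_g3cW_of_pt hP hGuard hc hγ hδ₁ hκ'0.le h2κ h4κ hκt.le hδ₀' hΛ n (hO φ hφ).1 hx _
      · exact g3cEG_of_ne_full Mc k (TC n) (TY n) x φ hX
    refine ⟨O, hOo, hSO, fun x hx => ⟨?_, fun φ hφ => ?_⟩, fun φ hφ => ?_⟩
    · exact (differentiableOn_g3cW hP hGuard hc hγ hδ₁ hκ'0.le h2κ h4κ hκt.le hδ₀' hΛ n hOo hO hx).congr fun φ hφ => hEq φ hφ x hx
    · show ‖g3cEG F Mc k (recordK₀ F Mc k + n) (TC n) (TY n) x X φ‖ ≤ _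
      rw [hEq φ hφ x hx]
      refine (norm_g3cW_le hP hGuard hc hγ hδ₁ hκ'0.le h2κ h4κ hκt.le hδ₀' hΛ n (hO φ hφ).1 hx).trans (le_of_eq ?_)
      rw [hBcdef]
      simp only [T4Family.P_d]
      ring
    · exact (continuousOn_g3cW hP hGuard hc hγ hδ₁ hκ'0.le h2κ h4κ hκt.le hδ₀' hΛ n (hO φ hφ).1).congr fun x hx => hEq φ hφ x (Set.mem_Ici.1 hx)

end Summit.QuantumFields.YangMills.Theorems.BalabanUVNodesPortS1

end
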